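import Summits.HodgeConjecture.HodgeConjecture.Theorems.MarkmanPartnerTransportPicardThreeK3SquaresSqrtSix
import Summits.HodgeConjecture.HodgeConjecture.Theorems.MarkmanPartnerTransportPicardThreeK3SquaresTranscendentalBuskin

/-!
# Route MarkmanPartnerTransport · crux `PicardThreeK3Squares` (stmt-HodgeConjecture-19652) —
# the `√6`-sector at Picard rank `≥ 12` UNDER Varesco's order-`3` lattice condition
# `T(X)_ℚ ↪ (U³ ⊕ A₂²) ⊗ ℚ` (explicit embedding hypothesis; the `U³ ⊕ E₈(−2)` condition is automatic)

Companion of `…SqrtSixCycle` / `…SqrtSix` (gen 4; there `ρ ≥ 15` makes BOTH lattice criteria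
automatic). At `ρ(X) ≥ 12` (`dim T(X)_ℚ ≤ 10`) the Nikulin criterion `T(X)_ℚ ↪ (U³ ⊕ E₈(−2)) ⊗ ℚ`
(dimension `14`) is still automatic by Kitaoka (codimension `≥ 4`), while the order-`3` criterion
(dimension `10`) is not; taking the latter as an explicit isometric embedding `ι₃` of the transcendental
coordinate vectors into `⟨1,1,1,−1,−1,−1,−2,−6,−2,−6⟩` (as in
`NikulinIsogeny.hodgeConjectureFor_square_of_twelve_le_of_sqrtThree_of_embedding`), the `√6` argument
goes through verbatim:

* `sqrtSix_cycleInduced_of_embedding` — `√6` is cycle-induced on `T(X)` (`ρ ≥ 12`, `ι₃` given).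
* `hodgeConjectureFor_square_of_twelve_le_of_sqrtSix_of_embedding` — HC⁴(X ⊗ X) for such `X`
  (e.g. the `ρ = 14`, `ρ = 12` K3 surfaces with real multiplication by `ℚ(√6)` that are Hodge
  isometric to a K3 surface with a symplectic automorphism of order `3`), modulo the same named facts.

No definition, no sorry. Prover seat hodge-nonav-19652-p1 (gen 4), `--supports stmt-HodgeConjecture-19652`.

References: M. Varesco, Math. Z. 305 (2023) §2, Prop. 2.5, Prop. 2.11; D. Huybrechts, Comment. Math.
Helv. 94 (2019) Cor. 0.4; Y. Kitaoka, *Arithmetic of Quadratic Forms*, Cor. 4.1.4.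
-/

set_option linter.dupNamespace false

noncomputable section

namespace Summit.HodgeConjecture.HodgeConjecture.Theorems.MarkmanPartnerTransport.SqrtSix

open scoped Manifold
open Module CategoryTheory MonoidalCategory CartesianMonoidalCategory
open Literature.AlgebraicGeometry Literature.AlgebraicGeometry.Motives Literature.AlgebraicGeometry.HodgeTheory
open Literature.AlgebraicGeometry.Surfaces
open Literature.AlgebraicTopology.SingularHomology
open Summit.HodgeConjecture.HodgeConjecture.Theorems
open Summit.HodgeConjecture.HodgeConjecture.Theorems.NikulinTwinTransport
open Summit.HodgeConjecture.HodgeConjecture.Theorems.NikulinTwinTransport.SquareGlueFree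
open Summit.HodgeConjecture.HodgeConjecture.Theorems.MarkmanPartnerTransport
open Summit.HodgeConjecture.HodgeConjecture.Theorems.MarkmanPartnerTransport.SimilitudeTranspose

variable {S : SchemeOver ℂ}

/-- `MarkedK3[S, η, p, x]`: VERBATIM the `let MarkedK3 := …` binder of the route declaration
`PicardThreeK3Squares`. Local notation only. -/
local notation3 (prettyPrint := false) "MarkedK3[" S ", " η ", " p ", " x "]" =>
  (p ≠ 0 ∧ (IsIntegralClass p ∧
    (∀ q : complexBetti S (2 * 2), IsIntegralClass q → ∃ n : ℤ, q = n • p) ∧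
    (∀ c : complexBetti S (2 * 1), IsIntegralClass c ↔ ∃ v : K3Index → ℤ, η c = fun i => (v i : ℂ)) ∧
    (∀ a b : complexBetti S (2 * 1),
      cupProduct (rfl : 2 * 1 + 2 * 1 = 2 * 2) a b = k3Form (η a) (η b) • p) ∧
    IsOfHodgeType 2 S (2 * 1) 2 0 (LinearEquiv.symm η x) ∧
    (∀ τ : complexBetti S (2 * 1), IsOfHodgeType 2 S (2 * 1) 2 0 τ →
      ∃ t : ℂ, τ = t • LinearEquiv.symm η x)) ∧
    (k3Form x x = 0 ∧ 0 < (k3Form (star x) x).re ∧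
      ∃ u : K3Index → ℤ, k3Form (fun i => (u i : ℂ)) x = 0 ∧ 0 < ∑ i, ∑ j, u i * k3Gram i j * u j))

/-- `Corr[μ, X, Y, hX, hY ; γ, y] = fst_* (snd^* y ∪ γ)` (`hX hY : IsSmoothProjective 2 _`). Local notation only. -/
local notation3 (prettyPrint := false) "Corr[" μ ", " X ", " Y ", " hX ", " hY " ; " γ ", " y "]" =>
  complexGysin μ (IsSmoothProjective.tensor_holds hX hY) hX (SemiCartesianMonoidalCategory.fst X Y)
    (rfl : 2 * 1 + 2 * 2 + 2 * 2 = 2 * 1 + 2 * (2 + 2))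
    (cupProduct (rfl : 2 * 1 + 2 * 2 = 2 * 1 + 2 * 2)
      (complexBetti.map (SemiCartesianMonoidalCategory.snd X Y) (2 * 1) y) γ)

/-- `Transp[X, Y ; γ] = swap^* γ`. Local notation only. -/
local notation3 (prettyPrint := false) "Transp[" X ", " Y " ; " γ "]" =>
  complexBetti.map (CartesianMonoidalCategory.lift (SemiCartesianMonoidalCategory.snd Y X)
    (SemiCartesianMonoidalCategory.fst Y X)) (2 * 2) γ

/-! ### The cycle exhibiting `√6`, `ρ ≥ 12`, order-`3` lattice condition as hypothesis -/

/-- **`√6` is cycle-induced at `ρ ≥ 12` under the order-`3` lattice condition.** As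
`SqrtSix.sqrtSix_cycleInduced`, with `ρ(X) ≥ 12` and the embedding
`ι₃ : T(X)_ℚ ↪ ⟨1,1,1,−1,−1,−1,−2,−6,−2,−6⟩` given (the Nikulin embedding stays automatic).
[cite: Varesco2023, §2 (starting observation), Prop. 2.5 and Prop. 2.11] [cite: Huybrechts2019, Cor. 0.4 (i)]
[cite: Kahn2020, §3.5.3 Lemma 3.48] -/
theorem sqrtSix_cycleInduced_of_embedding
    (hQ2 : Varesco2023_quotientSimilitude_two_of_transcendental_embedding)
    (hQ3 : Varesco2023_quotientSimilitude_three_of_transcendental_embedding)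
    (hH : Huybrechts2019_transcendentalHodgeIsometry_algebraic)
    (hS : IsK3Surface S)
    (η : complexBetti S (2 * 1) ≃ₗ[ℂ] (K3Index → ℂ)) (p : complexBetti S (2 * 2)) (x : K3Index → ℂ)
    (hM : MarkedK3[S, η, p, x]) (hρ : 12 ≤ Module.finrank ℂ ↥(algebraicClasses S 1))
    (ι₃ : (K3Index → ℚ) →ₗ[ℚ] (Fin 10 → ℚ))
    (hiso₃ : ∀ v w : K3Index → ℚ, IsTranscendentalCoord S η v → IsTranscendentalCoord S η w →
      ∑ i : Fin 10, (![1, 1, 1, -1, -1, -1, -2, -6, -2, -6] : Fin 10 → ℚ) i * ι₃ v i * ι₃ w i =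
        k3FormRat v w)
    (hinj₃ : ∀ v : K3Index → ℚ, IsTranscendentalCoord S η v → ι₃ v = 0 → v = 0)
    (ψ : complexBetti S (2 * 1) →ₗ[ℂ] complexBetti S (2 * 1))
    (hψT : Set.MapsTo ψ (transcendentalSubspace S) (transcendentalSubspace S))
    (hψrat : ∀ y, IsRationalClass y → IsRationalClass (ψ y))
    (hψtyp : ∀ (i j : ℕ) y, IsOfHodgeType 2 S (2 * 1) i j y → IsOfHodgeType 2 S (2 * 1) i j (ψ y))
    (hψsq : ∀ y ∈ transcendentalSubspace S, ψ (ψ y) = (6 : ℂ) • y)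
    (hψmul : ∀ y ∈ transcendentalSubspace S, ∀ z ∈ transcendentalSubspace S,
      cupProduct (rfl : 2 * 1 + 2 * 1 = 2 * 2) (ψ y) (ψ z) =
        (6 : ℂ) • cupProduct (rfl : 2 * 1 + 2 * 1 = 2 * 2) y z) :
    ∃ γ ∈ algebraicClasses (S ⊗ S) 2, ∀ z ∈ transcendentalSubspace S,
      Corr[complexOrientationFamily, S, S, hS.1, hS.1 ; γ, z] = ψ z := by
  classical
  have h4 : 2 * 1 + 2 * 1 = 2 * 2 := rfl
  have hM' := hM
  obtain ⟨hp₀, ⟨hpint, hpgen, hηint, hηcup, hx20, hxline⟩, -⟩ := hM'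
  have hsmul0 : ∀ {c : ℂ}, c • p = 0 → c = 0 := fun h => by
    rcases smul_eq_zero.1 h with h | h
    · exact h
    · exact absurd h hp₀
  -- `ψ` has multiplier `6` in the marking
  have hψk3 : ∀ a ∈ transcendentalSubspace S, ∀ b ∈ transcendentalSubspace S,
      k3Form (η (ψ a)) (η (ψ b)) = 6 * k3Form (η a) (η b) := by
    intro a ha b hb
    have h := hψmul a ha b hb
    rw [hηcup, hηcup, smul_smul] at h
    have h2 : (k3Form (η (ψ a)) (η (ψ b)) - 6 * k3Form (η a) (η b)) • p = 0 := by
      rw [sub_smul, h, sub_self]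
    exact sub_eq_zero.1 (hsmul0 h2)
  -- the Nikulin lattice embedding (Kitaoka, `dim T(X)_ℚ ≤ 10`)
  obtain ⟨ι₂, hiso₂, hinj₂⟩ := NikulinIsogeny.exists_transcendentalEmbedding_weightedSumSquares hS η p x hM
    (![1, 1, 1, -1, -1, -1, -1, -1, -1, -1, -1, -1, -1, -1] : Fin 14 → ℚ) u3e8Weights_ne_zero
    (by rw [ncard_u3e8Weights_pos]) (by rw [ncard_u3e8Weights_neg]; omega) (by omega)
  -- Varesco's quotient similitudes
  obtain ⟨Y₂, hY₂, η₂, p₂, x₂, hM₂, φ₂, γ₂, hγ₂alg, hφ₂, hφ₂rat, hφ₂typ, hφ₂T, hφ₂onto, hφ₂mul⟩ :=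
    hQ2 hS η p hp₀ hpint hpgen hηint hηcup ι₂ hiso₂ hinj₂
  obtain ⟨Y₃, hY₃, η₃, p₃, x₃, hM₃, φ₃, γ₃, hγ₃alg, hφ₃, hφ₃rat, hφ₃typ, hφ₃T, hφ₃onto, hφ₃mul⟩ :=
    hQ3 hS η p hp₀ hpint hpgen hηint hηcup ι₃ hiso₃ hinj₃
  have hM₂' := hM₂
  have hM₃' := hM₃
  obtain ⟨hp₂0, ⟨hp₂int, -, -, hη₂cup, hx₂20, hx₂line⟩, -⟩ := hM₂'
  obtain ⟨hp₃0, ⟨hp₃int, -, -, hη₃cup, hx₃20, hx₃line⟩, -⟩ := hM₃'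
  -- the transposes
  set φ₂t : complexBetti S (2 * 1) →ₗ[ℂ] complexBetti Y₂ (2 * 1) :=
    (complexGysin complexOrientationFamily (IsSmoothProjective.tensor_holds hY₂.1 hS.1) hY₂.1
        (SemiCartesianMonoidalCategory.fst Y₂ S) (rfl : 2 * 1 + 2 * 2 + 2 * 2 = 2 * 1 + 2 * (2 + 2))) ∘ₗ
      ((cupProduct (rfl : 2 * 1 + 2 * 2 = 2 * 1 + 2 * 2)).flip (Transp[S, Y₂ ; γ₂])) ∘ₗ
      (complexBetti.map (SemiCartesianMonoidalCategory.snd Y₂ S) (2 * 1)).hom with hφ₂tdef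
  have hφ₂t : ∀ w, φ₂t w = Corr[complexOrientationFamily, Y₂, S, hY₂.1, hS.1 ; Transp[S, Y₂ ; γ₂], w] :=
    fun w ↦ rfl
  set φ₃t : complexBetti S (2 * 1) →ₗ[ℂ] complexBetti Y₃ (2 * 1) :=
    (complexGysin complexOrientationFamily (IsSmoothProjective.tensor_holds hY₃.1 hS.1) hY₃.1
        (SemiCartesianMonoidalCategory.fst Y₃ S) (rfl : 2 * 1 + 2 * 2 + 2 * 2 = 2 * 1 + 2 * (2 + 2))) ∘ₗ
      ((cupProduct (rfl : 2 * 1 + 2 * 2 = 2 * 1 + 2 * 2)).flip (Transp[S, Y₃ ; γ₃])) ∘ₗ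
      (complexBetti.map (SemiCartesianMonoidalCategory.snd Y₃ S) (2 * 1)).hom with hφ₃tdef
  have hφ₃t : ∀ w, φ₃t w = Corr[complexOrientationFamily, Y₃, S, hY₃.1, hS.1 ; Transp[S, Y₃ ; γ₃], w] :=
    fun w ↦ rfl
  -- hypotheses of the transpose toolkit, in `Corr` form
  have hφ₂rat' : ∀ y, IsRationalClass y →
      IsRationalClass (Corr[complexOrientationFamily, S, Y₂, hS.1, hY₂.1 ; γ₂, y]) :=
    fun y hy ↦ by rw [← hφ₂]; exact hφ₂rat y hy
  have hφ₃rat' : ∀ y, IsRationalClass y →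
      IsRationalClass (Corr[complexOrientationFamily, S, Y₃, hS.1, hY₃.1 ; γ₃, y]) :=
    fun y hy ↦ by rw [← hφ₃]; exact hφ₃rat y hy
  have hφ₂typ' : ∀ y, IsOfHodgeType 2 Y₂ (2 * 1) 1 1 y →
      IsOfHodgeType 2 S (2 * 1) 1 1 (Corr[complexOrientationFamily, S, Y₂, hS.1, hY₂.1 ; γ₂, y]) :=
    fun y hy ↦ by rw [← hφ₂]; exact hφ₂typ 1 1 y hy
  have hφ₃typ' : ∀ y, IsOfHodgeType 2 Y₃ (2 * 1) 1 1 y →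
      IsOfHodgeType 2 S (2 * 1) 1 1 (Corr[complexOrientationFamily, S, Y₃, hS.1, hY₃.1 ; γ₃, y]) :=
    fun y hy ↦ by rw [← hφ₃]; exact hφ₃typ 1 1 y hy
  have hφ₂T' : ∀ y ∈ transcendentalSubspace Y₂,
      Corr[complexOrientationFamily, S, Y₂, hS.1, hY₂.1 ; γ₂, y] ∈ transcendentalSubspace S :=
    fun y hy ↦ by rw [← hφ₂]; exact hφ₂T y hy
  have hφ₃T' : ∀ y ∈ transcendentalSubspace Y₃,
      Corr[complexOrientationFamily, S, Y₃, hS.1, hY₃.1 ; γ₃, y] ∈ transcendentalSubspace S :=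
    fun y hy ↦ by rw [← hφ₃]; exact hφ₃T y hy
  have hφ₂onto' : ∀ z ∈ transcendentalSubspace S, ∃ y ∈ transcendentalSubspace Y₂,
      Corr[complexOrientationFamily, S, Y₂, hS.1, hY₂.1 ; γ₂, y] = z := fun z hz ↦ by
    obtain ⟨y, hy, hyz⟩ := hφ₂onto z hz
    exact ⟨y, hy, by rw [← hφ₂]; exact hyz⟩
  have hφ₃onto' : ∀ z ∈ transcendentalSubspace S, ∃ y ∈ transcendentalSubspace Y₃,
      Corr[complexOrientationFamily, S, Y₃, hS.1, hY₃.1 ; γ₃, y] = z := fun z hz ↦ by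
    obtain ⟨y, hy, hyz⟩ := hφ₃onto z hz
    exact ⟨y, hy, by rw [← hφ₃]; exact hyz⟩
  have hφ₂mul' : ∀ a ∈ transcendentalSubspace Y₂, ∀ b ∈ transcendentalSubspace Y₂,
      k3Form (η (Corr[complexOrientationFamily, S, Y₂, hS.1, hY₂.1 ; γ₂, a]))
        (η (Corr[complexOrientationFamily, S, Y₂, hS.1, hY₂.1 ; γ₂, b])) = (2 : ℂ) * k3Form (η₂ a) (η₂ b) :=
    fun a ha b hb ↦ by rw [← hφ₂, ← hφ₂]; exact hφ₂mul a ha b hb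
  have hφ₃mul' : ∀ a ∈ transcendentalSubspace Y₃, ∀ b ∈ transcendentalSubspace Y₃,
      k3Form (η (Corr[complexOrientationFamily, S, Y₃, hS.1, hY₃.1 ; γ₃, a]))
        (η (Corr[complexOrientationFamily, S, Y₃, hS.1, hY₃.1 ; γ₃, b])) = (3 : ℂ) * k3Form (η₃ a) (η₃ b) :=
    fun a ha b hb ↦ by rw [← hφ₃, ← hφ₃]; exact hφ₃mul a ha b hb
  -- the constants `c_p = p · ∫p_X / ∫p_{Y_p}`
  set c₂ : ℂ := 2 * traceC hS.1 p * (traceC hY₂.1 p₂)⁻¹ with hc₂def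
  set c₃ : ℂ := 3 * traceC hS.1 p * (traceC hY₃.1 p₃)⁻¹ with hc₃def
  have hτS : traceC hS.1 p ≠ 0 := fun h ↦ hp₀ (eq_zero_of_traceC_eq_zero hS.1 h)
  have hτ₂ : traceC hY₂.1 p₂ ≠ 0 := fun h ↦ hp₂0 (eq_zero_of_traceC_eq_zero hY₂.1 h)
  have hτ₃ : traceC hY₃.1 p₃ ≠ 0 := fun h ↦ hp₃0 (eq_zero_of_traceC_eq_zero hY₃.1 h)
  have hc₂0 : c₂ ≠ 0 := by
    rw [hc₂def]
    exact mul_ne_zero (mul_ne_zero two_ne_zero hτS) (inv_ne_zero hτ₂)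
  have hc₃0 : c₃ ≠ 0 := by
    rw [hc₃def]
    exact mul_ne_zero (mul_ne_zero three_ne_zero hτS) (inv_ne_zero hτ₃)
  -- `φ_p ᵗφ_p = c_p` on `T(X)` and `ᵗφ₂ φ₂ = c₂` on `T(Y₂)`; transposes map `T(X) → T(Y_p)`
  have key₂ : ∀ z ∈ transcendentalSubspace S, φ₂ (φ₂t z) = c₂ • z := fun z hz ↦ by
    rw [hφ₂t, hφ₂]
    exact comp_transpose_eq_smul hS.1 hY₂.1 η p η₂ p₂ hp₂0 hηcup hη₂cup γ₂ hφ₂rat' hφ₂typ' hφ₂T' hφ₂onto'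
      hφ₂mul' hz
  have key₂' : ∀ y ∈ transcendentalSubspace Y₂, φ₂t (φ₂ y) = c₂ • y := fun y hy ↦ by
    rw [hφ₂t, hφ₂]
    exact transpose_comp_eq_smul hS.1 hY₂.1 η p η₂ p₂ hp₂0 hηcup hη₂cup γ₂ hφ₂rat' hφ₂typ' hφ₂T' hφ₂mul' hy
  have key₃ : ∀ z ∈ transcendentalSubspace S, φ₃ (φ₃t z) = c₃ • z := fun z hz ↦ by
    rw [hφ₃t, hφ₃]
    exact comp_transpose_eq_smul hS.1 hY₃.1 η p η₃ p₃ hp₃0 hηcup hη₃cup γ₃ hφ₃rat' hφ₃typ' hφ₃T' hφ₃onto'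
      hφ₃mul' hz
  have hφ₂tT : ∀ z ∈ transcendentalSubspace S, φ₂t z ∈ transcendentalSubspace Y₂ := fun z hz ↦ by
    rw [hφ₂t]
    exact transpose_mem_transcendentalSubspace hS.1 hY₂.1 γ₂ hφ₂rat' hφ₂typ' hz
  have hφ₃tT : ∀ z ∈ transcendentalSubspace S, φ₃t z ∈ transcendentalSubspace Y₃ := fun z hz ↦ by
    rw [hφ₃t]
    exact transpose_mem_transcendentalSubspace hS.1 hY₃.1 γ₃ hφ₃rat' hφ₃typ' hz
  have hφ₂trat : ∀ z, IsRationalClass z → IsRationalClass (φ₂t z) := fun z hz ↦ by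
    rw [hφ₂t]
    exact isRationalClass_transpose hS.1 hY₂.1 γ₂ hφ₂rat' hz
  -- `c₂` is rational: `c₂ = 2 r_S / r₂` with `∫ p = r_S`, `∫ p₂ = r₂` rational (integral generators)
  obtain ⟨p₀, hp₀eq⟩ := (isRationalClass_iff_mem_range_ofRatClass _).1 hpint.isRationalClass
  obtain ⟨p₂₀, hp₂₀eq⟩ := (isRationalClass_iff_mem_range_ofRatClass _).1 hp₂int.isRationalClass
  set κ : ℚ := (3 * (2 * trace hS.1 p₀ * (trace hY₂.1 p₂₀)⁻¹))⁻¹ with hκdef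
  have hκ : (κ : ℂ) = ((3 : ℂ) * c₂)⁻¹ := by
    rw [hκdef, hc₂def, ← hp₀eq, ← hp₂₀eq, traceC_ofRatClass, traceC_ofRatClass]
    push_cast
    rfl
  -- the Hodge isometry `u = (3c₂)⁻¹ · ᵗφ₂ ∘ ψ ∘ φ₃ : H²(Y₃) → H²(Y₂)`
  set u : complexBetti Y₃ (2 * 1) →ₗ[ℂ] complexBetti Y₂ (2 * 1) :=
    ((3 : ℂ) * c₂)⁻¹ • (φ₂t ∘ₗ ψ ∘ₗ φ₃) with hudef
  have hu : ∀ y, u y = ((3 : ℂ) * c₂)⁻¹ • φ₂t (ψ (φ₃ y)) := fun y ↦ rfl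
  have huT : ∀ y ∈ transcendentalSubspace Y₃, u y ∈ transcendentalSubspace Y₂ := fun y hy ↦ by
    rw [hu]
    exact Submodule.smul_mem _ _ (hφ₂tT _ (hψT (hφ₃T y hy)))
  have huonto : ∀ z ∈ transcendentalSubspace Y₂, ∃ y ∈ transcendentalSubspace Y₃, u y = z := by
    intro z hz
    have hv : ((2 : ℂ)⁻¹ • ψ (φ₂ z)) ∈ transcendentalSubspace S :=
      Submodule.smul_mem _ _ (hψT (hφ₂T z hz))
    obtain ⟨y, hy, hyv⟩ := hφ₃onto _ hv
    refine ⟨y, hy, ?_⟩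
    rw [hu, hyv, map_smul, hψsq _ (hφ₂T z hz), map_smul, map_smul, key₂' z hz, smul_smul, smul_smul,
      smul_smul]
    have h : ((3 : ℂ) * c₂)⁻¹ * 2⁻¹ * 6 * c₂ = 1 := by
      field_simp
      ring
    rw [h, one_smul]
  have hurat : ∀ y ∈ transcendentalSubspace Y₃, IsRationalClass y → IsRationalClass (u y) := by
    intro y _ hy
    rw [hu, ← hκ]
    exact (hφ₂trat _ (hψrat _ (hφ₃rat y hy))).smul κ
  have huiso : ∀ a ∈ transcendentalSubspace Y₃, ∀ b ∈ transcendentalSubspace Y₃,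
      k3Form (η₂ (u a)) (η₂ (u b)) = k3Form (η₃ a) (η₃ b) := by
    intro a ha b hb
    have hA : ψ (φ₃ a) ∈ transcendentalSubspace S := hψT (hφ₃T a ha)
    have hB : ψ (φ₃ b) ∈ transcendentalSubspace S := hψT (hφ₃T b hb)
    -- `2 (η₂ ᵗφ₂A · η₂ ᵗφ₂B) = (η φ₂ᵗφ₂A · η φ₂ᵗφ₂B) = c₂² (ηA · ηB)`
    have h1 : k3Form (η₂ (φ₂t (ψ (φ₃ a)))) (η₂ (φ₂t (ψ (φ₃ b)))) =
        (2 : ℂ)⁻¹ * c₂ ^ 2 * k3Form (η (ψ (φ₃ a))) (η (ψ (φ₃ b))) := by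
      have h := hφ₂mul _ (hφ₂tT _ hA) _ (hφ₂tT _ hB)
      rw [key₂ _ hA, key₂ _ hB, map_smul, map_smul, k3Form_smul_left, k3Form_smul_right] at h
      linear_combination (-(2 : ℂ)⁻¹) * h
    rw [hu, hu, map_smul, map_smul, k3Form_smul_left, k3Form_smul_right, h1, hψk3 _ (hφ₃T a ha) _ (hφ₃T b hb),
      hφ₃mul a ha b hb]
    field_simp
    ring
  -- the period line: `u(η₃⁻¹ x₃) ∈ ℂ · η₂⁻¹ x₂`
  have hω₂T : η₂.symm x₂ ∈ transcendentalSubspace Y₂ :=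
    (mem_transcendentalSubspace_iff_forall_algebraicClasses hY₂.1 _).2
      fun d hd ↦ PgOneCyclotomicSquares.cup_eq_zero_of_twoZero hY₂.1 hx₂20 hd
  have hω₂ne : η₂.symm x₂ ≠ 0 := CyclotomicCM.period_ne_zero hM₂
  have huline : ∃ t : ℂ, u (η₃.symm x₃) = t • η₂.symm x₂ := by
    -- `φ₃ (η₃⁻¹x₃)` and then `ψ` of it are `(2,0)` on `X`
    obtain ⟨t₁, ht₁⟩ := hxline _ (hφ₃typ 2 0 _ hx₃20)
    obtain ⟨t₂, ht₂⟩ := hxline _ (hψtyp 2 0 _ hx20)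
    -- `φ₂ (η₂⁻¹x₂) = s • η⁻¹x` with `s ≠ 0`
    obtain ⟨s, hs⟩ := hxline _ (hφ₂typ 2 0 _ hx₂20)
    have hs0 : s ≠ 0 := by
      rintro rfl
      rw [zero_smul] at hs
      have h := key₂' _ hω₂T
      rw [hs, map_zero] at h
      exact hω₂ne (by
        have := h.symm
        rwa [smul_eq_zero, or_iff_right hc₂0] at this)
    have hline : φ₂t (η.symm x) = (s⁻¹ * c₂) • η₂.symm x₂ := by
      have h := key₂' _ hω₂T
      rw [hs, map_smul] at h
      rw [mul_smul, ← h, smul_smul, inv_mul_cancel₀ hs0, one_smul]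
    refine ⟨((3 : ℂ) * c₂)⁻¹ * (t₁ * t₂ * (s⁻¹ * c₂)), ?_⟩
    rw [hu, ht₁, map_smul, ht₂, map_smul, map_smul, hline, smul_smul, smul_smul, smul_smul]
    congr 1
    ring
  -- Buskin–Huybrechts: `u` is induced by an algebraic class on `Y₂ ⊗ Y₃`
  obtain ⟨γu, hγualg, hγu⟩ := hH hY₂ hY₃ η₂ p₂ x₂ η₃ p₃ x₃ hM₂ hM₃ u huT huonto hurat huiso huline
  -- compose: `γ₂ ∘ γu` on `X ⊗ Y₃`, then `∘ ᵗγ₃` on `X ⊗ X`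
  have hCUP := SquareOfGenerator.cupProduct_mem_algebraicClasses_tripleProduct
  obtain ⟨γA, hγAalg, hγA⟩ := corrComp_K3_of_cup complexOrientationFamily hCUP S Y₂ Y₃ hS hY₂ hY₃ γ₂ hγ₂alg γu hγualg
  have hγ₃talg : Transp[S, Y₃ ; γ₃] ∈ algebraicClasses (Y₃ ⊗ S) 2 :=
    transpose_mem_algebraicClasses hS.1 hY₃.1 hγ₃alg
  obtain ⟨γB, hγBalg, hγB⟩ := corrComp_K3_of_cup complexOrientationFamily hCUP S Y₃ S hS hY₃ hS γA hγAalg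
    (Transp[S, Y₃ ; γ₃]) hγ₃talg
  -- evaluate on `T(X)`: `[γB]_* z = (c₃/3) ψ z`
  have hBval : ∀ z ∈ transcendentalSubspace S,
      Corr[complexOrientationFamily, S, S, hS.1, hS.1 ; γB, z] = (c₃ * 3⁻¹) • ψ z := by
    intro z hz
    have hzt : φ₃t z ∈ transcendentalSubspace Y₃ := hφ₃tT z hz
    rw [hγB z, ← hφ₃t, hγA, ← hγu _ hzt, ← hφ₂, hu, map_smul]
    -- `φ₂ (ᵗφ₂ (ψ (φ₃ (ᵗφ₃ z)))) = c₂ ψ (c₃ z)`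
    have hin : ψ (φ₃ (φ₃t z)) ∈ transcendentalSubspace S := hψT (hφ₃T _ hzt)
    rw [key₂ _ hin, key₃ z hz, map_smul, smul_smul, smul_smul]
    congr 1
    field_simp
  refine ⟨((3 : ℂ) * c₃⁻¹) • γB, Submodule.smul_mem _ _ hγBalg, fun z hz ↦ ?_⟩
  rw [map_smul, map_smul, hBval z hz, smul_smul]
  have h : (3 : ℂ) * c₃⁻¹ * (c₃ * 3⁻¹) = 1 := by field_simp
  rw [h, one_smul]

/-- **HC⁴(S ⊗ S) for a marked projective K3 surface with `ρ(S) ≥ 12`, a `√6`-similitude of `T(S)`, and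
`T(S)_ℚ ↪ (U³ ⊕ A₂²) ⊗ ℚ`** (explicit `ι₃`), modulo `Buskin2019_hodgeIsometry_algebraic` (CM branch and,
through `transcendentalHodgeIsometry_algebraic_of_buskin`, the transcendental isometry),
`Huybrechts_K3_marking_exists` and `Varesco2023_quotientSimilitude_{two,three}_of_transcendental_embedding`.
[cite: Varesco2023, §2, Prop. 2.5, Prop. 2.11 and Rem. 2.16] [cite: Vangeemen2008, Lemma 3.2]
[cite: Buskin2019, Thm. 1.1 and Corollary] -/
theorem hodgeConjectureFor_square_of_twelve_le_of_sqrtSix_of_embedding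
    (hB : Buskin2019_hodgeIsometry_algebraic) (hmark : Huybrechts_K3_marking_exists)
    (hQ2 : Varesco2023_quotientSimilitude_two_of_transcendental_embedding)
    (hQ3 : Varesco2023_quotientSimilitude_three_of_transcendental_embedding)
    (hS : IsK3Surface S)
    (η : complexBetti S (2 * 1) ≃ₗ[ℂ] (K3Index → ℂ)) (p : complexBetti S (2 * 2)) (x : K3Index → ℂ)
    (hM : MarkedK3[S, η, p, x]) (hρ : 12 ≤ Module.finrank ℂ ↥(algebraicClasses S 1))
    (ι₃ : (K3Index → ℚ) →ₗ[ℚ] (Fin 10 → ℚ))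
    (hiso₃ : ∀ v w : K3Index → ℚ, IsTranscendentalCoord S η v → IsTranscendentalCoord S η w →
      ∑ i : Fin 10, (![1, 1, 1, -1, -1, -1, -2, -6, -2, -6] : Fin 10 → ℚ) i * ι₃ v i * ι₃ w i =
        k3FormRat v w)
    (hinj₃ : ∀ v : K3Index → ℚ, IsTranscendentalCoord S η v → ι₃ v = 0 → v = 0)
    (ψ : complexBetti S (2 * 1) →ₗ[ℂ] complexBetti S (2 * 1))
    (hψrat : ∀ y, IsRationalClass y → IsRationalClass (ψ y))
    (hψtyp : ∀ (i j : ℕ) y, IsOfHodgeType 2 S (2 * 1) i j y → IsOfHodgeType 2 S (2 * 1) i j (ψ y))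
    (hψsq : ∀ y ∈ transcendentalSubspace S, ψ (ψ y) = (6 : ℂ) • y)
    (hψmul : ∀ y ∈ transcendentalSubspace S, ∀ z ∈ transcendentalSubspace S,
      cupProduct (rfl : 2 * 1 + 2 * 1 = 2 * 2) (ψ y) (ψ z) =
        (6 : ℂ) • cupProduct (rfl : 2 * 1 + 2 * 1 = 2 * 2) y z) :
    HodgeConjectureFor 4 (S ⊗ S) := by
  have h6 : ¬ IsSquare (6 : ℕ) := by
    rintro ⟨r, hr⟩
    have hr3 : r < 3 := by nlinarith
    interval_cases r <;> omega
  rcases NikulinIsogeny.sqrtSector_or_hasComplexMultiplication_of_natCast h6 hS η p x hM hρ ψ hψrat hψtyp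
      (fun y hy ↦ by simpa using hψsq y hy)
      (fun y hy z hz ↦ by simpa using hψmul y hy z hz) with hsec | hCM
  · obtain ⟨hψT, -, -, -, -, hU⟩ := hsec
    obtain ⟨γ, hγalg, hγ⟩ := sqrtSix_cycleInduced_of_embedding hQ2 hQ3
      (NikulinIsogeny.transcendentalHodgeIsometry_algebraic_of_buskin hB) hS η p x hM hρ ι₃ hiso₃ hinj₃ ψ
      hψT hψrat hψtyp hψsq hψmul
    exact hodgeConjectureFor_square_of_corr_similitude hS ψ
      ((complexGysin complexOrientationFamily (IsSmoothProjective.tensor_holds hS.1 hS.1) hS.1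
          (SemiCartesianMonoidalCategory.fst S S) (rfl : 2 * 1 + 2 * 2 + 2 * 2 = 2 * 1 + 2 * (2 + 2))) ∘ₗ
        ((cupProduct (rfl : 2 * 1 + 2 * 2 = 2 * 1 + 2 * 2)).flip γ) ∘ₗ
        (complexBetti.map (SemiCartesianMonoidalCategory.snd S S) (2 * 1)).hom)
      γ hγalg (fun _ ↦ rfl) (fun z hz ↦ hγ z hz) hU
  · exact CMThird.hodgeConjectureFor_square_of_CM_of_buskin hB hmark S hS hCM

end Summit.HodgeConjecture.HodgeConjecture.Theorems.MarkmanPartnerTransport.SqrtSix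

end
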